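import Mathlib
import Summits.Schanuel.Schanuel.Theses.SurplusLinkage
import Literature.Barriers.Schanuel.AlgebraicIndependenceOfLogarithms
import Literature.NumberTheory.Transcendental.LindemannWeierstrassProofs
import Literature.NumberTheory.Transcendental.SchanuelSectorSplit

/-!
# Birth skeleton (BC3) for crux `SurplusNonneg` (item stmt-Schanuel-18994, route `SurplusLinkage`)

Seat `planner-skel-stmt-Schanuel-18994-0` (skeleton-register one-shot; route re-audit bin HONEST),
2026-08-17. The crux `Summit.Schanuel.Schanuel.Theses.SurplusLinkage.SurplusNonneg` (rank 3 of
route-Schanuel-SurplusLinkage) reads: for `ℚ`-linearly independent `z : Fin n → ℂ`,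
`n ≤ trdeg_ℚ ℚ(z₁, …, zₙ) + trdeg_ℚ ℚ(e^{z₁}, …, e^{zₙ})` ("surplus `σ = a + b − n ≥ 0`").

## The line (the route header's TWO-LAYER PLAN for this node, made formal)

Split the hypothesis space by the two classical FACES of the `(a, b)`-square, `a = trdeg ℚ(z)`,
`b = trdeg ℚ(e^z)`:

* `a = 0` (every `zᵢ` algebraic): `n ≤ b` is the **Lindemann–Weierstrass theorem** — a THEOREM of
  the tree (`Literature.NumberTheory.Transcendental.algebraicIndependent_exp_holds`), so it is NOT a
  stub: it is discharged inside the composition (`lindemannFace` below, sorry-free).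
* `b = 0` (every `e^{zᵢ}` algebraic, i.e. `zᵢ ∈ 𝓛 = exp⁻¹(ℚ̄)`): `n ≤ a` is the **conjecture of
  algebraic independence of logarithms of algebraic numbers** — STUB 1 `stub_logFace`, stated
  byte-identically to the tree's registered open statement
  `Literature.Barriers.Schanuel.AlgIndepLogarithms` (calibration `Iff.rfl` below), converted to the
  `trdeg` form by `le_trdeg_adjoin_of_algebraicIndependent'`.
* `a ≥ 1 ∧ b ≥ 1` (a transcendental entry AND a transcendental exponential — the MIXED FACE):
  empty for `n ≤ 2` (`a + b ≥ 2 ≥ n`, proved in the composition from `trdeg_pos`); its first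
  genuine instance `n = 3` is STUB 2 `stub_mixedFaceThree` (small-transcendence-degree territory:
  it contains Gel'fond 1949 — `z = (log α)(1, β, β²)`, `β` cubic, `a = 1`, `b = 2`, in tree as
  `Diaz1989_holds.gelfond1949` — and is open at `z = (log 2, (log 2)², (log 2)³)`); `n ≥ 4` is
  STUB 3 `stub_mixedFaceLarge` (large-transcendence-degree territory: at `a = 1` it asks
  `b ≥ n − 1`, beyond the Gel'fond–Philippon–Diaz ceiling `[(d+1)/2]`, LNM 1752 Ch. 14 Cor. 2.8).

`SurplusNonneg_of : stub_logFace → stub_mixedFaceThree → stub_mixedFaceLarge → SurplusNonneg` is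
the kernel-checked composition (no `sorry`; case split on the faces, LW from the tree, AIL via the
`trdeg` conversion, `n ≤ 2` by `trdeg_pos`). The split is EXACT: each stub is also a consequence of
the crux (`logFace_of_surplusNonneg`, `mixedFaceThree_of_surplusNonneg`,
`mixedFaceLarge_of_surplusNonneg`, sorry-free), so no stub is stronger than the crux.

Sorries: exactly 3, one inside each `stub_*`; zero elsewhere.
-/

noncomputable section

namespace Summit.Schanuel.Schanuel.Cruxes.SurplusNonneg.Birth

open Summit.Schanuel.Schanuel.Theses.SurplusLinkage (SurplusNonneg)
open Literature.Barriers.Schanuel (AlgIndepLogarithms algebraicIndependent_of_le_trdeg_adjoin)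
open Literature.NumberTheory.Transcendental (le_trdeg_adjoin_of_algebraicIndependent'
  algebraicIndependent_exp_holds)
open IntermediateField

/-! ### Registered stubs -/

/-- STUB 1 (OPEN — the LOG FACE `b = 0`; byte-identical to the tree's registered open statement
`Literature.Barriers.Schanuel.AlgIndepLogarithms`, Waldschmidt 2005 Conj. 1.1, Lang 1966): if
`l₁, …, lₙ` are `ℚ`-linearly independent logarithms of algebraic numbers (`e^{lᵢ} ∈ ℚ̄`), then
they are algebraically independent over `ℚ`; equivalently (`le_trdeg_adjoin_of_algebraicIndependent'`
/ `algebraicIndependent_of_le_trdeg_adjoin`) `n ≤ trdeg_ℚ ℚ(l)`, i.e. `SurplusNonneg` on the face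
`trdeg ℚ(e^l) = 0`. Why it might fail / stall: it is Barrier B1's horizon
(`Literature.Barriers.Schanuel.AlgebraicIndependenceOfLogarithms`): not even two algebraically
independent logarithms are known; `n = 1` is Hermite–Lindemann (tree). Size XL (open problem).
[cite: Waldschmidt2005, §1 Conjecture 1.1] [cite: Lang1966, Ch. III Historical Note] -/
theorem stub_logFace :
    ∀ (n : ℕ) (l : Fin n → ℂ), (∀ i, IsAlgebraic ℚ (Complex.exp (l i))) → LinearIndependent ℚ l →
      AlgebraicIndependent ℚ l := by
  sorry

/-- STUB 2 (OPEN — the MIXED FACE at its first genuine instance `n = 3`): if `z₁, z₂, z₃ ∈ ℂ` are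
`ℚ`-linearly independent, some `zᵢ` is transcendental and some `e^{zⱼ}` is transcendental, then
`3 ≤ trdeg_ℚ ℚ(z) + trdeg_ℚ ℚ(e^z)`; equivalently the pattern `a = b = 1` does not occur at
`n = 3`. Small-transcendence-degree territory (Gel'fond's criterion / Brownawell–Waldschmidt):
contains Gel'fond 1949 (`(log α)(1, β, β²)`, `β` cubic: tree `Diaz1989_holds.gelfond1949`) and the
`(1, e, e²)` pattern; open in general (e.g. `z = (log 2, (log 2)², (log 2)³)` asks that
`2^{log 2}, 2^{(log 2)²}` be algebraically independent). Why it might fail / stall: at `a = 1` with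
a transcendental base `t ∉ 𝓛` no zero estimate separates `e^{t}, e^{t²}` from an algebraic curve —
nothing printed covers `a = b = 1` off the Gel'fond tuples. Size XL.
[cite: NesterenkoPhilippon2001, Ch. 14 Thm 2.9] [cite: Gelfond1949] [cite: BakerTNT1975, Ch. 12] -/
theorem stub_mixedFaceThree :
    ∀ (z : Fin 3 → ℂ), LinearIndependent ℚ z →
      (∃ i, Transcendental ℚ (z i)) → (∃ i, Transcendental ℚ (Complex.exp (z i))) →
      (3 : Cardinal) ≤ Algebra.trdeg ℚ ↥(IntermediateField.adjoin ℚ (Set.range z)) +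
        Algebra.trdeg ℚ ↥(IntermediateField.adjoin ℚ (Set.range (Complex.exp ∘ z))) := by
  sorry

/-- STUB 3 (OPEN — the MIXED FACE for `n ≥ 4`): if `z : Fin n → ℂ`, `n ≥ 4`, is `ℚ`-linearly
independent with a transcendental entry and a transcendental exponential, then
`n ≤ trdeg_ℚ ℚ(z) + trdeg_ℚ ℚ(e^z)`. Large-transcendence-degree territory: already at `a = 1`
(all `zᵢ` algebraic over one transcendental `t`) it asks `trdeg ℚ(e^z) ≥ n − 1`, which for the
Gel'fond tuples `(log α)(1, β, …, β^{n−1})` exceeds Diaz's `[(n+1)/2]` (tree `Diaz1989_holds`) as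
soon as `n ≥ 4`. Why it might fail / stall: beyond the Philippon–Diaz ceiling without the technical
hypothesis (Barrier `Literature.Barriers.Schanuel.LargeTranscendenceDegree`); true if Schanuel.
Size XL. [cite: NesterenkoPhilippon2001, Ch. 14 Cor. 2.8] [cite: Diaz1989, Théorème 1] -/
theorem stub_mixedFaceLarge :
    ∀ (n : ℕ) (z : Fin n → ℂ), LinearIndependent ℚ z → 4 ≤ n →
      (∃ i, Transcendental ℚ (z i)) → (∃ i, Transcendental ℚ (Complex.exp (z i))) →
      (n : Cardinal) ≤ Algebra.trdeg ℚ ↥(IntermediateField.adjoin ℚ (Set.range z)) +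
        Algebra.trdeg ℚ ↥(IntermediateField.adjoin ℚ (Set.range (Complex.exp ∘ z))) := by
  sorry

/-! ### Stub statements by name -/

namespace Statement

/-- Statement of `stub_logFace`. -/
abbrev stub_logFace : Prop := type_of% @Birth.stub_logFace
/-- Statement of `stub_mixedFaceThree`. -/
abbrev stub_mixedFaceThree : Prop := type_of% @Birth.stub_mixedFaceThree
/-- Statement of `stub_mixedFaceLarge`. -/
abbrev stub_mixedFaceLarge : Prop := type_of% @Birth.stub_mixedFaceLarge

end Statement

/-! ### Calibration: stub 1 IS the tree's registered conjecture -/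

example : Statement.stub_logFace ↔ AlgIndepLogarithms := Iff.rfl

/-! ### Glue lemmas (sorry-free) -/

/-- One transcendental value among the generators gives transcendence degree `≥ 1`. [folklore] -/
theorem one_le_trdeg_adjoin_of_transcendental {ι : Type} {y : ι → ℂ} {i : ι}
    (h : Transcendental ℚ (y i)) :
    1 ≤ Algebra.trdeg ℚ ↥(adjoin ℚ (Set.range y)) := by
  have ht : Transcendental ℚ (⟨y i, subset_adjoin ℚ _ ⟨i, rfl⟩⟩ : adjoin ℚ (Set.range y)) :=
    fun ha => h (isAlgebraic_iff.mp ha)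
  haveI : Algebra.Transcendental ℚ ↥(adjoin ℚ (Set.range y)) := ⟨⟨_, ht⟩⟩
  exact Cardinal.one_le_iff_pos.mpr (trdeg_pos ℚ _)

/-- If every generator is algebraic, the generated field has transcendence degree `0`. [folklore] -/
theorem trdeg_adjoin_eq_zero_of_isAlgebraic {ι : Type} {y : ι → ℂ}
    (h : ∀ i, IsAlgebraic ℚ (y i)) :
    Algebra.trdeg ℚ ↥(adjoin ℚ (Set.range y)) = 0 := by
  haveI : Algebra.IsAlgebraic ℚ ↥(adjoin ℚ (Set.range y)) :=
    isAlgebraic_adjoin (by rintro _ ⟨i, rfl⟩; exact (h i).isIntegral)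
  exact trdeg_eq_zero

/-- **The Lindemann–Weierstrass face** (`a = 0`) of `SurplusNonneg`, PROVED from the tree's
Lindemann–Weierstrass theorem `algebraicIndependent_exp_holds`: for algebraic, `ℚ`-linearly
independent `z`, `n ≤ trdeg_ℚ ℚ(e^z)`. [cite: BakerTNT1975, Ch. 1 §3, remark after Theorem 1.4, p. 6] -/
theorem lindemannFace (n : ℕ) (z : Fin n → ℂ) (hz : LinearIndependent ℚ z)
    (halg : ∀ i, IsAlgebraic ℚ (z i)) :
    (n : Cardinal) ≤ Algebra.trdeg ℚ ↥(IntermediateField.adjoin ℚ (Set.range (Complex.exp ∘ z))) := by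
  have hai : AlgebraicIndependent ℚ fun i => Complex.exp (z i) :=
    algebraicIndependent_exp_holds z halg hz
  have h := le_trdeg_adjoin_of_algebraicIndependent' hai
  rw [Fintype.card_fin] at h
  exact h

/-- **The log face** (`b = 0`) of `SurplusNonneg` in `trdeg` form, from STUB 1's statement.
[folklore] -/
theorem logFace_trdeg (hlog : Statement.stub_logFace) (n : ℕ) (z : Fin n → ℂ)
    (hz : LinearIndependent ℚ z) (halg : ∀ i, IsAlgebraic ℚ (Complex.exp (z i))) :
    (n : Cardinal) ≤ Algebra.trdeg ℚ ↥(IntermediateField.adjoin ℚ (Set.range z)) := by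
  have h := le_trdeg_adjoin_of_algebraicIndependent' (hlog n z halg hz)
  rw [Fintype.card_fin] at h
  exact h

/-! ### The crux from the stubs (kernel-checked composition, no `sorry`) -/

/-- **`SurplusNonneg` BY NAME from the three stub statements**: case split on the faces of the
`(a, b)`-square — `a = 0` by Lindemann–Weierstrass (tree theorem), `b = 0` by STUB 1, and on the
mixed face `n ≤ 2` by `1 ≤ a`, `1 ≤ b` (`trdeg_pos`), `n = 3` by STUB 2, `n ≥ 4` by STUB 3.
[folklore] -/
theorem SurplusNonneg_of (hlog : Statement.stub_logFace) (h3 : Statement.stub_mixedFaceThree)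
    (h4 : Statement.stub_mixedFaceLarge) :
    Summit.Schanuel.Schanuel.Theses.SurplusLinkage.SurplusNonneg := by
  intro n z hz
  by_cases hA : ∀ i, IsAlgebraic ℚ (z i)
  · exact (lindemannFace n z hz hA).trans le_add_self
  by_cases hB : ∀ i, IsAlgebraic ℚ (Complex.exp (z i))
  · exact (logFace_trdeg hlog n z hz hB).trans le_self_add
  push Not at hA hB
  obtain ⟨i, hi⟩ := hA
  obtain ⟨j, hj⟩ := hB
  rcases lt_or_ge n 3 with hn | hn
  · -- `n ≤ 2`: one transcendental entry and one transcendental exponential already give `2`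
    have h1 : 1 ≤ Algebra.trdeg ℚ ↥(IntermediateField.adjoin ℚ (Set.range z)) :=
      one_le_trdeg_adjoin_of_transcendental hi
    have h2 : 1 ≤ Algebra.trdeg ℚ ↥(IntermediateField.adjoin ℚ (Set.range (Complex.exp ∘ z))) :=
      one_le_trdeg_adjoin_of_transcendental (y := Complex.exp ∘ z) (i := j) hj
    calc (n : Cardinal) ≤ 1 + 1 := by exact_mod_cast (show n ≤ 1 + 1 by omega)
      _ ≤ _ := add_le_add h1 h2
  rcases hn.eq_or_lt with h3n | h4n
  · subst h3n
    exact_mod_cast h3 z hz ⟨i, hi⟩ ⟨j, hj⟩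
  · exact h4 n z hz h4n ⟨i, hi⟩ ⟨j, hj⟩

/-- The crux along this line MODULO exactly the three registered stubs (depends on `sorryAx` only
through `stub_*`). -/
theorem SurplusNonneg_proof : Summit.Schanuel.Schanuel.Theses.SurplusLinkage.SurplusNonneg :=
  SurplusNonneg_of stub_logFace stub_mixedFaceThree stub_mixedFaceLarge

/-! ### The split is exact: each stub is a consequence of the crux (informational, sorry-free) -/

/-- `SurplusNonneg` on the log face gives STUB 1 (there `trdeg ℚ(e^l) = 0`). [folklore] -/
theorem logFace_of_surplusNonneg (h : SurplusNonneg) : Statement.stub_logFace := by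
  intro n l halg hli
  have h0 : Algebra.trdeg ℚ ↥(adjoin ℚ (Set.range (Complex.exp ∘ l))) = 0 :=
    trdeg_adjoin_eq_zero_of_isAlgebraic (y := Complex.exp ∘ l) halg
  have hn := h n l hli
  rw [h0, add_zero] at hn
  exact algebraicIndependent_of_le_trdeg_adjoin l hn

/-- `SurplusNonneg` at `n = 3` gives STUB 2. [folklore] -/
theorem mixedFaceThree_of_surplusNonneg (h : SurplusNonneg) : Statement.stub_mixedFaceThree := by
  intro z hz _ _
  exact_mod_cast h 3 z hz

/-- `SurplusNonneg` for `n ≥ 4` gives STUB 3. [folklore] -/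
theorem mixedFaceLarge_of_surplusNonneg (h : SurplusNonneg) : Statement.stub_mixedFaceLarge :=
  fun n z hz _ _ _ => h n z hz

end Summit.Schanuel.Schanuel.Cruxes.SurplusNonneg.Birth

end
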